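import Summits.Parity.BatemanHorn.Theses.SelbergLift

/-!
# Birth skeleton — crux `LargePairStratum` (route `SelbergLift`, item `stmt-Parity-18414`)

Line `birth` (skeleton registrar, BC3).  Notation of the route file: a Bateman–Horn system
`f = (f₁,…,f_k)`, a lifted index `i`, `d = deg fᵢ`, `C = C(f) = batemanHornConst f` (the `Λ`-normalised
singular series), `w(n) = ∏_{j ≠ i} Λ(f_j(n))`, and for `0 < ε < 1/4` the BOTH-FACTORS-LARGE stratum of the
pair part of Selberg's `Λ₂(fᵢ(n))`:

  `Large_ε(x) := Σ_{1 ≤ n ≤ x} Σ_{ab = fᵢ(n), min(a,b) > x^{1-ε}} Λ(a)Λ(b) · w(n)`.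

The crux: for every system and index there is `η(ε) → 0 (ε → 0⁺)` with, eventually in `x`,
`|Large_ε(x) − (d − 2 + 2ε)₊ · C · x log x| ≤ η(ε) · x log x`.

The line cuts the crux BY THE DEGREE `d` OF THE LIFTED MEMBER and, in the top case, BY SIDE — the four
pieces are different theorems needing different tools, and the composition does the (elementary but
real) `ε`-bookkeeping (nonnegativity of `Large`, `|C|`, `max` of two slacks):

* `stub_linearVanishing` (`d ≤ 1`, EVERY integer polynomial family, no BH hypothesis): `Large_ε(x) = 0`
  for all large `x` — `min(a,b)² ≤ ab = fᵢ(n) ≤ A·x < x^{2−2ε}`.  PROVABLE NOW (size M).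
* `stub_quadraticSliver` (`d = 2`): `Large_ε(x) ≤ η(ε)·x log x` with `η → 0` — an `O(ε)`-share UPPER
  bound only (the crux's main term `2ε·C·x log x` is itself `O(ε)`, so no lower bound is needed; the
  composition adds `2ε|C|` to the slack).  Balanced semiprime values `fᵢ(n) = pq`, `x^{1−ε} < p ≤ q
  ≪ x^{1+ε}`: switch to the larger prime and sieve it with Type-I information for divisors of
  quadratic values BEYOND `x` (de la Bretèche–Drappeau level, Merikoski arXiv:1908.08816 Prop. 3) —
  size L for `k = 1`; the uniformity over the other members `f_j` is not in print for `k ≥ 2`.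
* `stub_highDegreeUpper` (`d ≥ 3`): `Large_ε(x) ≤ ((d−2+2ε)·C + η(ε))·x log x` — the upper half WITH
  THE SHARP CONSTANT.  Open: sieves give `O_ε(x log x)` only (Bateman–Horn (2)); the sharp constant
  already needs the distribution of the roots of `fᵢ mod p` for primes `p ∈ (x^{1−ε}, x^{d/2}]` seen from
  `n ≤ x < p` (root equidistribution to PRIME moduli in degree `≥ 3`, open; DFI 1995 / Tóth 2000 are
  quadratic).
* `stub_highDegreeLower` (`d ≥ 3`): `((d−2+2ε)·C − η(ε))·x log x ≤ Large_ε(x)` — the lower half: a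
  `P₂`-statement with both primes `> x^{1−ε} ≥ n^{1−ε}` along a polynomial of degree `≥ 3` (and the other
  members prime).  Open and parity-sensitive: the record for an irreducible `f` of degree `g ≥ 3` is
  `P_{g+1}` (Greaves, Sieves in Number Theory, p. 143, Cor. 1.4), and at sifting level `s → 1⁺` the
  lower-bound sieve function vanishes.

`of_cases (h1 : sig₁) (h2 : sig₂) (h3 : sig₃) (h4 : sig₄) : <body of LargePairStratum>` is PROVED below
(trichotomy `d ≤ 1 ∣ d = 2 ∣ d ≥ 3`; `η := 0`, `η + 2ε|C|`, `max η_U η_L` respectively); THE SKELETON THEOREM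
`LargePairStratum_of : SelbergLift.LargePairStratum` (no hypotheses) applies it to the four stubs BY NAME, and an
anonymous `example : sig₁ → sig₂ → sig₃ → sig₄ → SelbergLift.LargePairStratum` records the hypothesis form.
The only `sorry`s of the file are the four `stub_*`.

Disproof used: none relevant — `ledger crux ls stmt-Parity-18414`: no workfiles (no `Disproof.lean`, no
`Negative/` lemma) on 2026-08-17; `ledger negatives --problem Parity` lists stmt-Parity-9541 / 14832 / 4218
(GHL side: sieve-sequence moments, inverse-sieve tuples, rectangle Chowla) — no stub restates one.
Refuter vetting note used (refuter-rattack-stmt-Parity-18414-0, 2026-08-17): degenerate `d ≤ 1` ⇒ sum `= 0`,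
`η ≡ 0`; `d = 2` ⇒ content is the upper bound only; `d ≥ 3` ⇒ two-sided `P₂`-asymptotic beyond print;
normalisation `(d−2+2ε)·C` checked against numerics (`X³+2`, `x = 10⁵`).
-/

namespace Summit.Parity.BatemanHorn.Cruxes.LargePairStratum.Birth

open scoped BigOperators Topology
open Filter

/-! ### Registered stubs (the only `sorry`s of the line) -/

/-- stub (LINEAR OR CONSTANT LIFTED MEMBER — the stratum is EMPTY; provable now, size M):
for every family `f : Fin k → ℤ[X]` (no Bateman–Horn hypothesis needed), every index `i` with
`deg fᵢ ≤ 1` and every `0 < ε < 1/4`: for all sufficiently large `x` the large-stratum sum VANISHES.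
Why true: `fᵢ(n).toNat ≤ A·n + B ≤ (A+B)·x` for `1 ≤ n ≤ x`; a divisor pair `a · (m/a) ≤ m` of
`m = fᵢ(n).toNat` has `min(a, m/a)² ≤ m ≤ (A+B)·x`, while the bracket asks `min(a, m/a) > x^{1−ε}`, i.e.
`x^{2−2ε} < (A+B)·x`, impossible once `x^{1−2ε} ≥ x^{1/2} > A+B`; so every `if` is `false` and the sum is `0`.
Mathlib: `Polynomial.eq_X_add_C_of_natDegree_le_one`, `Nat.div_mul_le_self` / `Nat.mul_div_le`,
`Real.rpow_le_rpow_left_iff`, `Real.rpow_natCast`, `Finset.sum_eq_zero`.  In the crux the main term is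
`(d − 2 + 2ε)₊ = 0` here, so this stub IS the crux for `d ≤ 1` (e.g. both members of the twin system). -/
theorem stub_linearVanishing :
    ∀ (k : ℕ) (f : Fin k → Polynomial ℤ) (i : Fin k), (f i).natDegree ≤ 1 →
    ∀ ε : ℝ, 0 < ε → ε < 1 / 4 → ∀ᶠ x : ℕ in Filter.atTop,
      (∑ n ∈ Finset.Icc 1 x, (∑ a ∈ (((f i).eval (n : ℤ)).toNat).divisors,
        if (x : ℝ) ^ (1 - ε) < ((min a ((((f i).eval (n : ℤ)).toNat) / a) : ℕ) : ℝ) then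
          ArithmeticFunction.vonMangoldt a * ArithmeticFunction.vonMangoldt ((((f i).eval (n : ℤ)).toNat) / a)
        else 0) * ∏ j ∈ Finset.univ.erase i, ArithmeticFunction.vonMangoldt (((f j).eval (n : ℤ)).toNat)) = 0 := by
  sorry

/-- stub (QUADRATIC LIFTED MEMBER — the `O(ε)`-SLIVER of balanced semiprimes; size L for `k = 1`,
frontier for `k ≥ 2`): for every Bateman–Horn system `f`, index `i` with `deg fᵢ = 2`, there is
`η : ℝ → ℝ` with `η(ε) → 0` as `ε → 0⁺` such that for `0 < ε < 1/4`, eventually in `x`,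
`Large_ε(x) ≤ η(ε) · x · log x` — an UPPER bound only (the crux's main term `2ε·C·x log x` is itself an
`O(ε)` share, absorbed into the slack by `LargePairStratum_of`).
Why plausibly true: a surviving term has `fᵢ(n) = ab ≤ A x²` with `a, b > x^{1−ε}` prime powers, so (up to
`O(x^{(1+ε)/2+o(1)})` from proper powers) `fᵢ(n) = pq` with `x^{1−ε} < p ≤ q ≤ A x^{1+ε}`; the expected mass is
`Σ_{x^{1−ε} < p ≤ √A·x} ρᵢ(p) log p / p · (…) ≍ ε · C · x log x`.  Switch to the LARGER prime `q ∈ [x^{1-ε}, A x^{1+ε}]`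
and bound `#{n ≤ x : q ∣ fᵢ(n), fᵢ(n)/q prime, f_j(n) prime (j ≠ i)}` by an upper-bound sieve on the
divisor variable: this needs Type-I information for divisors `m ~ P ∈ [x, x^{1+ε}]` of the quadratic values
`fᵢ(n)`, `n ≤ x` — BEYOND `x`, i.e. equidistribution of the roots `ν/m` of `fᵢ mod m` at scale `x/m < 1` —
which for quadratics is the Duke–Friedlander–Iwaniec / de la Bretèche–Drappeau theory: Merikoski,
arXiv:1908.08816, p. 5, Prop. 3 (Type-I information of de la Bretèche–Drappeau for `n²+1`, `x ≤ P ≤ x^{2−η}`,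
sieve level `D = x^{(32−7α)/50−η}`, `α = log P/log x`), de la Bretèche–Drappeau arXiv:1703.03197 (JEMS 2020)
for quadratic polynomials; any fixed sieve constant is harmless since only an `O(ε)` share is claimed
(`η(ε) = K_f · ε`).  What is NOT in print: the same Type-I information for the JOINT root classes of a
system with further members `f_j` (`k ≥ 2`), and general quadratics with the `Λ`/prime-power bookkeeping of
the route's typing.  Sources: IwaniecInventiones1978, LemkeOliverActaArith2012, arXiv:1908.08816,
arXiv:1703.03197, Ford2004 (divisor-window density, heuristic size of the sliver). -/
theorem stub_quadraticSliver :
    ∀ (k : ℕ) (f : Fin k → Polynomial ℤ) (i : Fin k), Literature.NumberTheory.Sieve.IsBatemanHornSystem f →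
    (f i).natDegree = 2 →
    ∃ η : ℝ → ℝ, Filter.Tendsto η (nhdsWithin 0 (Set.Ioi 0)) (nhds 0) ∧ ∀ ε : ℝ, 0 < ε → ε < 1 / 4 →
      ∀ᶠ x : ℕ in Filter.atTop,
      (∑ n ∈ Finset.Icc 1 x, (∑ a ∈ (((f i).eval (n : ℤ)).toNat).divisors,
        if (x : ℝ) ^ (1 - ε) < ((min a ((((f i).eval (n : ℤ)).toNat) / a) : ℕ) : ℝ) then
          ArithmeticFunction.vonMangoldt a * ArithmeticFunction.vonMangoldt ((((f i).eval (n : ℤ)).toNat) / a)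
        else 0) * ∏ j ∈ Finset.univ.erase i, ArithmeticFunction.vonMangoldt (((f j).eval (n : ℤ)).toNat)) ≤ η ε * (x : ℝ) * Real.log x := by
  sorry

/-- stub (DEGREE `≥ 3`, UPPER HALF WITH THE SHARP CONSTANT; open): for every Bateman–Horn system `f` and
index `i` with `d = deg fᵢ ≥ 3` there is `η(ε) → 0 (ε → 0⁺)` with, for `0 < ε < 1/4`, eventually in `x`,
`Large_ε(x) ≤ ((d − 2 + 2ε)·C(f) + η(ε)) · x log x`.
Why plausibly true: random-model share of `Λ∗Λ` on pairs with `min > x^{1−ε}` inside an integer of size `x^d`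
is `(d − 2(1−ε)) log x` per unit mass, times the Bateman–Horn density of the other members; refuter numerics
(`X³+2`, `x = 10⁵`): `Large_ε/(C x log x) = 0.862 / 0.959 / 1.158` against the prediction `0.839 / 0.939 / 1.139`
at `ε = 0.05 / 0.1 / 0.2`.  What is known: `Large_ε(x) = O_ε(x log x)` only (upper-bound sieve of dimension `k`
on the `x^{1−ε}`-rough values, Bateman–Horn (2); constant off by a factor `≥ 2`).  The sharp constant already
requires counting `#{(n,p) : n ≤ x, p ∈ (P, 2P], p ∣ fᵢ(n)}` for `x < P < x^{d/2}` with the expected main term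
`x Σ ρᵢ(p)/p`, i.e. equidistribution of the roots of `fᵢ mod p` to PRIME moduli at scale `x/P < 1` — open in
degree `≥ 3` (Duke–Friedlander–Iwaniec 1995 and Tóth 2000 are quadratic; Hooley 1964 needs composite
moduli).  Size: open problem.  Sources: Ford2004, BatemanHornMathComp1962 (2), DukeFriedlanderIwaniec1995,
Hooley1964. -/
theorem stub_highDegreeUpper :
    ∀ (k : ℕ) (f : Fin k → Polynomial ℤ) (i : Fin k), Literature.NumberTheory.Sieve.IsBatemanHornSystem f →
    3 ≤ (f i).natDegree →
    ∃ η : ℝ → ℝ, Filter.Tendsto η (nhdsWithin 0 (Set.Ioi 0)) (nhds 0) ∧ ∀ ε : ℝ, 0 < ε → ε < 1 / 4 →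
      ∀ᶠ x : ℕ in Filter.atTop,
      (∑ n ∈ Finset.Icc 1 x, (∑ a ∈ (((f i).eval (n : ℤ)).toNat).divisors,
        if (x : ℝ) ^ (1 - ε) < ((min a ((((f i).eval (n : ℤ)).toNat) / a) : ℕ) : ℝ) then
          ArithmeticFunction.vonMangoldt a * ArithmeticFunction.vonMangoldt ((((f i).eval (n : ℤ)).toNat) / a)
        else 0) * ∏ j ∈ Finset.univ.erase i, ArithmeticFunction.vonMangoldt (((f j).eval (n : ℤ)).toNat)) ≤ ((((f i).natDegree : ℝ) - 2 + 2 * ε) * Literature.NumberTheory.Sieve.batemanHornConst f + η ε) * (x : ℝ) * Real.log x := by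
  sorry

/-- stub (DEGREE `≥ 3`, LOWER HALF; open, parity-sensitive): for every Bateman–Horn system `f` and index
`i` with `d = deg fᵢ ≥ 3` there is `η(ε) → 0 (ε → 0⁺)` with, for `0 < ε < 1/4`, eventually in `x`,
`((d − 2 + 2ε)·C(f) − η(ε)) · x log x ≤ Large_ε(x)`.
Why plausibly true: the same heuristic and numerics as the upper half.  Content: since `(d−2+2ε)·C ≥ C > 0`,
it asserts in particular infinitely many `n` with `fᵢ(n) = pq`, both primes `> x^{1−ε} ≥ n^{1−ε}`, and every
other `f_j(n)` prime — a `P₂` theorem with both prime factors beyond the length of the `n`-range for a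
polynomial of degree `≥ 3`.  The record for an irreducible `f` of degree `g` is `P_{g+1}` (Greaves, Sieves in
Number Theory, p. 143, Cor. 1.4: "R = g + 1 has not been improved, except in the case g = 2" — Iwaniec 1978),
and a lower-bound sieve at sifting level `s = log(level)/log x^{1−ε} → 1⁺` returns `f(s) = 0` (Selberg's parity
examples): no Type-I/II route is known.  Size: open problem.  Sources: IwaniecInventiones1978,
Greaves2001 p.143 Cor 1.4, Selberg1949, FordMaynard (thin-set / minimal Type-II barriers). -/
theorem stub_highDegreeLower :
    ∀ (k : ℕ) (f : Fin k → Polynomial ℤ) (i : Fin k), Literature.NumberTheory.Sieve.IsBatemanHornSystem f →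
    3 ≤ (f i).natDegree →
    ∃ η : ℝ → ℝ, Filter.Tendsto η (nhdsWithin 0 (Set.Ioi 0)) (nhds 0) ∧ ∀ ε : ℝ, 0 < ε → ε < 1 / 4 →
      ∀ᶠ x : ℕ in Filter.atTop,
      ((((f i).natDegree : ℝ) - 2 + 2 * ε) * Literature.NumberTheory.Sieve.batemanHornConst f - η ε) * (x : ℝ) * Real.log x ≤
      (∑ n ∈ Finset.Icc 1 x, (∑ a ∈ (((f i).eval (n : ℤ)).toNat).divisors,
        if (x : ℝ) ^ (1 - ε) < ((min a ((((f i).eval (n : ℤ)).toNat) / a) : ℕ) : ℝ) then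
          ArithmeticFunction.vonMangoldt a * ArithmeticFunction.vonMangoldt ((((f i).eval (n : ℤ)).toNat) / a)
        else 0) * ∏ j ∈ Finset.univ.erase i, ArithmeticFunction.vonMangoldt (((f j).eval (n : ℤ)).toNat)) := by
  sorry

/-! ### Glue (all proved) -/

/-- The large-stratum sum `Large_ε(x)` of the crux (verbatim the function inside `SelbergLift.LargePairStratum`). -/
noncomputable def largeSum {k : ℕ} (f : Fin k → Polynomial ℤ) (i : Fin k) (ε : ℝ) (x : ℕ) : ℝ :=
  (∑ n ∈ Finset.Icc 1 x, (∑ a ∈ (((f i).eval (n : ℤ)).toNat).divisors,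
        if (x : ℝ) ^ (1 - ε) < ((min a ((((f i).eval (n : ℤ)).toNat) / a) : ℕ) : ℝ) then
          ArithmeticFunction.vonMangoldt a * ArithmeticFunction.vonMangoldt ((((f i).eval (n : ℤ)).toNat) / a)
        else 0) * ∏ j ∈ Finset.univ.erase i, ArithmeticFunction.vonMangoldt (((f j).eval (n : ℤ)).toNat))

/-- `Large_ε(x) ≥ 0` (every weight is a product of von Mangoldt values). [folklore] -/
theorem largeSum_nonneg {k : ℕ} (f : Fin k → Polynomial ℤ) (i : Fin k) (ε : ℝ) (x : ℕ) :
    0 ≤ largeSum f i ε x := by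
  unfold largeSum
  refine Finset.sum_nonneg fun n _ => mul_nonneg (Finset.sum_nonneg fun a _ => ?_)
    (Finset.prod_nonneg fun j _ => ArithmeticFunction.vonMangoldt_nonneg)
  split_ifs
  · exact mul_nonneg ArithmeticFunction.vonMangoldt_nonneg ArithmeticFunction.vonMangoldt_nonneg
  · exact le_rfl

/-- `ε`-bookkeeping of the quadratic case: a nonnegative quantity below `h·t` is within `(h + e|c|)·t` of
any main term `e·c·t` with `e, t ≥ 0`. [folklore] -/
theorem abs_sub_le_of_nonneg_of_le {S h e c t : ℝ} (hS : 0 ≤ S) (hSt : S ≤ h * t) (he : 0 ≤ e)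
    (ht : 0 ≤ t) : |S - e * c * t| ≤ (h + e * |c|) * t := by
  have h1 : |e * c * t| = e * |c| * t := by
    rw [abs_mul, abs_mul, abs_of_nonneg he, abs_of_nonneg ht]
  have h2 := abs_le.1 h1.le
  have h3 : (h + e * |c|) * t = h * t + e * |c| * t := by ring
  rw [abs_le]
  constructor
  · linarith [h2.1, h2.2]
  · linarith [h2.1, h2.2]

/-- `ε`-bookkeeping of the high-degree case: an upper bound `(m + u)·t` and a lower bound `(m − l)·t`
put `S` within `max u l · t` of `m·t` (`t ≥ 0`). [folklore] -/
theorem abs_sub_le_of_two_sided {S m u l t : ℝ} (hU : S ≤ (m + u) * t) (hL : (m - l) * t ≤ S)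
    (ht : 0 ≤ t) : |S - m * t| ≤ max u l * t := by
  have h1 : l * t ≤ max u l * t := mul_le_mul_of_nonneg_right (le_max_right u l) ht
  have h2 : u * t ≤ max u l * t := mul_le_mul_of_nonneg_right (le_max_left u l) ht
  have h3 : (m - l) * t = m * t - l * t := by ring
  have h4 : (m + u) * t = m * t + u * t := by ring
  rw [abs_le]
  constructor
  · linarith
  · linarith

/-! ### Composition: the four stubs give the crux BY NAME -/

/-- CASE ANALYSIS IN HYPOTHESIS FORM (kernel-checked, sorry-free): from the four stub STATEMENTS as hypotheses
`h1 … h4`, the body of `SelbergLift.LargePairStratum` (verbatim) for every system and index.  Proof: trichotomy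
on `d = deg fᵢ`.  `d ≤ 1`: the sum is eventually `0` and `(d−2+2ε)₊ = 0`, take `η ≡ 0`.  `d = 2`: `(d−2+2ε)₊ = 2ε`;
`0 ≤ Large ≤ η(ε) x log x` gives `|Large − 2εC x log x| ≤ (η(ε) + 2ε|C|) x log x`, and `η + 2ε|C| → 0`.  `d ≥ 3`:
`(d−2+2ε)₊ = d−2+2ε`; the two one-sided bounds give slack `max(η_U, η_L) → 0`. -/
theorem of_cases
    (h1 : ∀ (k : ℕ) (f : Fin k → Polynomial ℤ) (i : Fin k), (f i).natDegree ≤ 1 →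
    ∀ ε : ℝ, 0 < ε → ε < 1 / 4 → ∀ᶠ x : ℕ in Filter.atTop,
      (∑ n ∈ Finset.Icc 1 x, (∑ a ∈ (((f i).eval (n : ℤ)).toNat).divisors,
        if (x : ℝ) ^ (1 - ε) < ((min a ((((f i).eval (n : ℤ)).toNat) / a) : ℕ) : ℝ) then
          ArithmeticFunction.vonMangoldt a * ArithmeticFunction.vonMangoldt ((((f i).eval (n : ℤ)).toNat) / a)
        else 0) * ∏ j ∈ Finset.univ.erase i, ArithmeticFunction.vonMangoldt (((f j).eval (n : ℤ)).toNat)) = 0)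
    (h2 : ∀ (k : ℕ) (f : Fin k → Polynomial ℤ) (i : Fin k), Literature.NumberTheory.Sieve.IsBatemanHornSystem f →
    (f i).natDegree = 2 →
    ∃ η : ℝ → ℝ, Filter.Tendsto η (nhdsWithin 0 (Set.Ioi 0)) (nhds 0) ∧ ∀ ε : ℝ, 0 < ε → ε < 1 / 4 →
      ∀ᶠ x : ℕ in Filter.atTop,
      (∑ n ∈ Finset.Icc 1 x, (∑ a ∈ (((f i).eval (n : ℤ)).toNat).divisors,
        if (x : ℝ) ^ (1 - ε) < ((min a ((((f i).eval (n : ℤ)).toNat) / a) : ℕ) : ℝ) then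
          ArithmeticFunction.vonMangoldt a * ArithmeticFunction.vonMangoldt ((((f i).eval (n : ℤ)).toNat) / a)
        else 0) * ∏ j ∈ Finset.univ.erase i, ArithmeticFunction.vonMangoldt (((f j).eval (n : ℤ)).toNat)) ≤ η ε * (x : ℝ) * Real.log x)
    (h3 : ∀ (k : ℕ) (f : Fin k → Polynomial ℤ) (i : Fin k), Literature.NumberTheory.Sieve.IsBatemanHornSystem f →
    3 ≤ (f i).natDegree →
    ∃ η : ℝ → ℝ, Filter.Tendsto η (nhdsWithin 0 (Set.Ioi 0)) (nhds 0) ∧ ∀ ε : ℝ, 0 < ε → ε < 1 / 4 →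
      ∀ᶠ x : ℕ in Filter.atTop,
      (∑ n ∈ Finset.Icc 1 x, (∑ a ∈ (((f i).eval (n : ℤ)).toNat).divisors,
        if (x : ℝ) ^ (1 - ε) < ((min a ((((f i).eval (n : ℤ)).toNat) / a) : ℕ) : ℝ) then
          ArithmeticFunction.vonMangoldt a * ArithmeticFunction.vonMangoldt ((((f i).eval (n : ℤ)).toNat) / a)
        else 0) * ∏ j ∈ Finset.univ.erase i, ArithmeticFunction.vonMangoldt (((f j).eval (n : ℤ)).toNat)) ≤ ((((f i).natDegree : ℝ) - 2 + 2 * ε) * Literature.NumberTheory.Sieve.batemanHornConst f + η ε) * (x : ℝ) * Real.log x)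
    (h4 : ∀ (k : ℕ) (f : Fin k → Polynomial ℤ) (i : Fin k), Literature.NumberTheory.Sieve.IsBatemanHornSystem f →
    3 ≤ (f i).natDegree →
    ∃ η : ℝ → ℝ, Filter.Tendsto η (nhdsWithin 0 (Set.Ioi 0)) (nhds 0) ∧ ∀ ε : ℝ, 0 < ε → ε < 1 / 4 →
      ∀ᶠ x : ℕ in Filter.atTop,
      ((((f i).natDegree : ℝ) - 2 + 2 * ε) * Literature.NumberTheory.Sieve.batemanHornConst f - η ε) * (x : ℝ) * Real.log x ≤
      (∑ n ∈ Finset.Icc 1 x, (∑ a ∈ (((f i).eval (n : ℤ)).toNat).divisors,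
        if (x : ℝ) ^ (1 - ε) < ((min a ((((f i).eval (n : ℤ)).toNat) / a) : ℕ) : ℝ) then
          ArithmeticFunction.vonMangoldt a * ArithmeticFunction.vonMangoldt ((((f i).eval (n : ℤ)).toNat) / a)
        else 0) * ∏ j ∈ Finset.univ.erase i, ArithmeticFunction.vonMangoldt (((f j).eval (n : ℤ)).toNat))) :
    ∀ (k : ℕ) (f : Fin k → Polynomial ℤ) (i : Fin k), Literature.NumberTheory.Sieve.IsBatemanHornSystem f →
    ∃ η : ℝ → ℝ, Filter.Tendsto η (nhdsWithin 0 (Set.Ioi 0)) (nhds 0) ∧ ∀ ε : ℝ, 0 < ε → ε < 1 / 4 →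
      ∀ᶠ x : ℕ in Filter.atTop,
      |(∑ n ∈ Finset.Icc 1 x, (∑ a ∈ (((f i).eval (n : ℤ)).toNat).divisors,
        if (x : ℝ) ^ (1 - ε) < ((min a ((((f i).eval (n : ℤ)).toNat) / a) : ℕ) : ℝ) then
          ArithmeticFunction.vonMangoldt a * ArithmeticFunction.vonMangoldt ((((f i).eval (n : ℤ)).toNat) / a)
        else 0) * ∏ j ∈ Finset.univ.erase i, ArithmeticFunction.vonMangoldt (((f j).eval (n : ℤ)).toNat)) -
        max (((f i).natDegree : ℝ) - 2 + 2 * ε) 0 * Literature.NumberTheory.Sieve.batemanHornConst f * (x : ℝ) *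
          Real.log x| ≤ η ε * (x : ℝ) * Real.log x := by
  intro k f i hf
  rcases Nat.lt_or_ge (f i).natDegree 2 with hd | hd
  · -- `deg fᵢ ≤ 1`: empty stratum, zero main term, `η ≡ 0`.
    refine ⟨fun _ => 0, tendsto_const_nhds, fun ε hε hε4 => ?_⟩
    filter_upwards [h1 k f i (by omega) ε hε hε4] with x hx
    have hdR : ((f i).natDegree : ℝ) ≤ 1 := by exact_mod_cast (show (f i).natDegree ≤ 1 by omega)
    have hmax : max (((f i).natDegree : ℝ) - 2 + 2 * ε) 0 = 0 := max_eq_right (by linarith)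
    rw [hx, hmax]
    simp
  · rcases Nat.eq_or_lt_of_le hd with hd2 | hd3
    · -- `deg fᵢ = 2`: the sliver; slack `η(ε) + 2ε|C|`.
      obtain ⟨η, hη, h⟩ := h2 k f i hf hd2.symm
      refine ⟨fun ε => η ε + 2 * ε * |Literature.NumberTheory.Sieve.batemanHornConst f|, ?_,
        fun ε hε hε4 => ?_⟩
      · have hc : Continuous fun ε : ℝ => 2 * ε * |Literature.NumberTheory.Sieve.batemanHornConst f| :=
          (continuous_const.mul continuous_id).mul continuous_const
        have h0 : Filter.Tendsto (fun ε : ℝ => 2 * ε * |Literature.NumberTheory.Sieve.batemanHornConst f|)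
            (nhdsWithin 0 (Set.Ioi 0)) (nhds 0) := by
          refine tendsto_nhdsWithin_of_tendsto_nhds ?_
          simpa using hc.tendsto 0
        simpa only [add_zero] using hη.add h0
      · filter_upwards [h ε hε hε4] with x hx
        have hS : 0 ≤ largeSum f i ε x := largeSum_nonneg f i ε x
        have hx0 : (0 : ℝ) ≤ (x : ℝ) := Nat.cast_nonneg x
        have hl : 0 ≤ Real.log (x : ℝ) := Real.log_natCast_nonneg x
        have hxl : 0 ≤ (x : ℝ) * Real.log (x : ℝ) := mul_nonneg hx0 hl
        have hdR : ((f i).natDegree : ℝ) = 2 := by exact_mod_cast hd2.symm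
        have hmax : max (((f i).natDegree : ℝ) - 2 + 2 * ε) 0 = 2 * ε := by
          rw [hdR, show (2 : ℝ) - 2 + 2 * ε = 2 * ε by ring]
          exact max_eq_left (by linarith)
        rw [hmax]
        have hx' : largeSum f i ε x ≤ η ε * ((x : ℝ) * Real.log (x : ℝ)) := by
          have := hx
          unfold largeSum
          exact this.trans_eq (by ring)
        have key := abs_sub_le_of_nonneg_of_le (c := Literature.NumberTheory.Sieve.batemanHornConst f)
          hS hx' (by linarith : (0 : ℝ) ≤ 2 * ε) hxl
        have e1 : 2 * ε * Literature.NumberTheory.Sieve.batemanHornConst f * (x : ℝ) * Real.log (x : ℝ) =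
            2 * ε * Literature.NumberTheory.Sieve.batemanHornConst f * ((x : ℝ) * Real.log (x : ℝ)) := by ring
        have e2 : (η ε + 2 * ε * |Literature.NumberTheory.Sieve.batemanHornConst f|) * (x : ℝ) * Real.log (x : ℝ) =
            (η ε + 2 * ε * |Literature.NumberTheory.Sieve.batemanHornConst f|) * ((x : ℝ) * Real.log (x : ℝ)) := by
          ring
        rw [e1, e2]
        exact key
    · -- `deg fᵢ ≥ 3`: two-sided, slack `max (η_U ε) (η_L ε)`.
      have hd3' : 3 ≤ (f i).natDegree := hd3
      obtain ⟨ηU, hηU, hU⟩ := h3 k f i hf hd3'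
      obtain ⟨ηL, hηL, hL⟩ := h4 k f i hf hd3'
      refine ⟨fun ε => max (ηU ε) (ηL ε), by simpa only [max_self] using hηU.max hηL, fun ε hε hε4 => ?_⟩
      filter_upwards [hU ε hε hε4, hL ε hε hε4] with x hxU hxL
      have hx0 : (0 : ℝ) ≤ (x : ℝ) := Nat.cast_nonneg x
      have hl : 0 ≤ Real.log (x : ℝ) := Real.log_natCast_nonneg x
      have hxl : 0 ≤ (x : ℝ) * Real.log (x : ℝ) := mul_nonneg hx0 hl
      have hdR : (3 : ℝ) ≤ ((f i).natDegree : ℝ) := by exact_mod_cast hd3'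
      have hmax : max (((f i).natDegree : ℝ) - 2 + 2 * ε) 0 = ((f i).natDegree : ℝ) - 2 + 2 * ε :=
        max_eq_left (by linarith)
      rw [hmax]
      have hU' : largeSum f i ε x ≤ ((((f i).natDegree : ℝ) - 2 + 2 * ε) *
          Literature.NumberTheory.Sieve.batemanHornConst f + ηU ε) * ((x : ℝ) * Real.log (x : ℝ)) := by
        have := hxU
        unfold largeSum
        exact this.trans_eq (by ring)
      have hL' : ((((f i).natDegree : ℝ) - 2 + 2 * ε) * Literature.NumberTheory.Sieve.batemanHornConst f - ηL ε) *
          ((x : ℝ) * Real.log (x : ℝ)) ≤ largeSum f i ε x := by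
        have := hxL
        unfold largeSum
        exact Eq.trans_le (by ring) this
      have key := abs_sub_le_of_two_sided hU' hL' hxl
      have e1 : (((f i).natDegree : ℝ) - 2 + 2 * ε) * Literature.NumberTheory.Sieve.batemanHornConst f * (x : ℝ) *
          Real.log (x : ℝ) = (((f i).natDegree : ℝ) - 2 + 2 * ε) * Literature.NumberTheory.Sieve.batemanHornConst f *
          ((x : ℝ) * Real.log (x : ℝ)) := by ring
      have e2 : max (ηU ε) (ηL ε) * (x : ℝ) * Real.log (x : ℝ) = max (ηU ε) (ηL ε) * ((x : ℝ) * Real.log (x : ℝ)) := by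
        ring
      rw [e1, e2]
      exact key

/-- THE SKELETON THEOREM: the crux `SelbergLift.LargePairStratum` BY NAME from the four registered stubs
(no hypotheses, no `sorry` here; `#print axioms` today = the stubs' `sorryAx` + the standard three). -/
theorem LargePairStratum_of : Summit.Parity.BatemanHorn.Theses.SelbergLift.LargePairStratum := by
  intro k f i hf
  exact of_cases stub_linearVanishing stub_quadraticSliver stub_highDegreeUpper stub_highDegreeLower k f i hf

/-- ASSEMBLY IN HYPOTHESIS FORM concluding the crux constant itself (kernel-checked, sorry-free):
`stub_linearVanishing-sig → stub_quadraticSliver-sig → stub_highDegreeUpper-sig → stub_highDegreeLower-sig →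
SelbergLift.LargePairStratum`. -/
example :
    (∀ (k : ℕ) (f : Fin k → Polynomial ℤ) (i : Fin k), (f i).natDegree ≤ 1 →
    ∀ ε : ℝ, 0 < ε → ε < 1 / 4 → ∀ᶠ x : ℕ in Filter.atTop,
      (∑ n ∈ Finset.Icc 1 x, (∑ a ∈ (((f i).eval (n : ℤ)).toNat).divisors,
        if (x : ℝ) ^ (1 - ε) < ((min a ((((f i).eval (n : ℤ)).toNat) / a) : ℕ) : ℝ) then
          ArithmeticFunction.vonMangoldt a * ArithmeticFunction.vonMangoldt ((((f i).eval (n : ℤ)).toNat) / a)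
        else 0) * ∏ j ∈ Finset.univ.erase i, ArithmeticFunction.vonMangoldt (((f j).eval (n : ℤ)).toNat)) = 0) →
    (∀ (k : ℕ) (f : Fin k → Polynomial ℤ) (i : Fin k), Literature.NumberTheory.Sieve.IsBatemanHornSystem f →
    (f i).natDegree = 2 →
    ∃ η : ℝ → ℝ, Filter.Tendsto η (nhdsWithin 0 (Set.Ioi 0)) (nhds 0) ∧ ∀ ε : ℝ, 0 < ε → ε < 1 / 4 →
      ∀ᶠ x : ℕ in Filter.atTop,
      (∑ n ∈ Finset.Icc 1 x, (∑ a ∈ (((f i).eval (n : ℤ)).toNat).divisors,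
        if (x : ℝ) ^ (1 - ε) < ((min a ((((f i).eval (n : ℤ)).toNat) / a) : ℕ) : ℝ) then
          ArithmeticFunction.vonMangoldt a * ArithmeticFunction.vonMangoldt ((((f i).eval (n : ℤ)).toNat) / a)
        else 0) * ∏ j ∈ Finset.univ.erase i, ArithmeticFunction.vonMangoldt (((f j).eval (n : ℤ)).toNat)) ≤ η ε * (x : ℝ) * Real.log x) →
    (∀ (k : ℕ) (f : Fin k → Polynomial ℤ) (i : Fin k), Literature.NumberTheory.Sieve.IsBatemanHornSystem f →
    3 ≤ (f i).natDegree →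
    ∃ η : ℝ → ℝ, Filter.Tendsto η (nhdsWithin 0 (Set.Ioi 0)) (nhds 0) ∧ ∀ ε : ℝ, 0 < ε → ε < 1 / 4 →
      ∀ᶠ x : ℕ in Filter.atTop,
      (∑ n ∈ Finset.Icc 1 x, (∑ a ∈ (((f i).eval (n : ℤ)).toNat).divisors,
        if (x : ℝ) ^ (1 - ε) < ((min a ((((f i).eval (n : ℤ)).toNat) / a) : ℕ) : ℝ) then
          ArithmeticFunction.vonMangoldt a * ArithmeticFunction.vonMangoldt ((((f i).eval (n : ℤ)).toNat) / a)
        else 0) * ∏ j ∈ Finset.univ.erase i, ArithmeticFunction.vonMangoldt (((f j).eval (n : ℤ)).toNat)) ≤ ((((f i).natDegree : ℝ) - 2 + 2 * ε) * Literature.NumberTheory.Sieve.batemanHornConst f + η ε) * (x : ℝ) * Real.log x) →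
    (∀ (k : ℕ) (f : Fin k → Polynomial ℤ) (i : Fin k), Literature.NumberTheory.Sieve.IsBatemanHornSystem f →
    3 ≤ (f i).natDegree →
    ∃ η : ℝ → ℝ, Filter.Tendsto η (nhdsWithin 0 (Set.Ioi 0)) (nhds 0) ∧ ∀ ε : ℝ, 0 < ε → ε < 1 / 4 →
      ∀ᶠ x : ℕ in Filter.atTop,
      ((((f i).natDegree : ℝ) - 2 + 2 * ε) * Literature.NumberTheory.Sieve.batemanHornConst f - η ε) * (x : ℝ) * Real.log x ≤
      (∑ n ∈ Finset.Icc 1 x, (∑ a ∈ (((f i).eval (n : ℤ)).toNat).divisors,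
        if (x : ℝ) ^ (1 - ε) < ((min a ((((f i).eval (n : ℤ)).toNat) / a) : ℕ) : ℝ) then
          ArithmeticFunction.vonMangoldt a * ArithmeticFunction.vonMangoldt ((((f i).eval (n : ℤ)).toNat) / a)
        else 0) * ∏ j ∈ Finset.univ.erase i, ArithmeticFunction.vonMangoldt (((f j).eval (n : ℤ)).toNat))) →
    Summit.Parity.BatemanHorn.Theses.SelbergLift.LargePairStratum := by
  intro h1 h2 h3 h4 k f i hf
  exact of_cases h1 h2 h3 h4 k f i hf

end Summit.Parity.BatemanHorn.Cruxes.LargePairStratum.Birth
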